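import Literature.NumberTheory.EllipticCurves.Shintani32KohnenKernelLaw
import Literature.NumberTheory.EllipticCurves.ShintaniGenericLiftQExpansion32
import Literature.NumberTheory.EllipticCurves.Shintani32KohnenGenusTriviality
import HarnessLib

/-!
# The Kohnen-type lift `Φ_D` of a level-`32` cusp form: cusp form in `S_{3/2}(128, 1)`, the family `G_D`, the symmetry

[[cite: Shintani1975, §2, Thm. 1, Thm. 2, Prop. 2.4]] [[cite: Tunnell1983Congruent, p. 329]] — two parts:

**Part 1 (cusp conditions).** For `D ≡ 3 (mod 4)` square-free and `φ ∈ S₂(Γ₀(32))`, the lift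
`Φ_D(z) = ∫_{Γ₀(32)∖ℍ} φ(w) 𝒦_D(w, z) dμ(w)` against the Kohnen-type kernel
(`Shintani32KohnenKernelLaw.kerK`, the generic lift `liftG χ_{D*} (1/D)` of `ShintaniGenericLift32`)
belongs to `halfIntCuspForms 3 128 1` (`kohnenLift_mem`).  Holomorphy and the level-`128` law are
those of the generic chain and of the kernel; the CUSP CONDITIONS at every cusp are proved here:
the transformed weights (Gauss coefficient sums `S_g(v) = ∑_{r mod N} w_D(r) ψ_N(aΔ(r) + ℓ(r,v))`)
are again `Γ₀(32)`-invariant and bounded (`invWeight32_transWt`, the pairing `ℓ = B/64`), the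
kernel at `gz` is a generic kernel at `ζ = z + d/c` (`kerK_smul_eq_genKernel32`), and
`|κ(Z')| = (N|cz+d|)^{5/2}/(8√2)` with the generic decay `norm_liftG_le` give
`slashSq 3 Φ_D g → 0` at `i∞` for every `g ∈ SL₂(ℤ)` (`isZeroAtImInfty_slashSq_kohnenLift`);
`qCoeffs_kohnenLift` identifies the coefficients.

**Part 2 (the family and the symmetry).** For `G_D := (2/√D) Φ_D` (`kohnenFamily`):
`a_{G_D}(n) = ∑_{ω : Δ(k_ω)/D = n} χ_{D*}(Q_ω) u(ω)` with the orbit datum `u(ω) = sgn(λ_ω) P(ω)`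
INDEPENDENT of `D` (`orbDatum`, `qCoeffs_kohnenFamily`), and hypothesis (H2) of the
symmetric-family endgame (`TunnellWaldspurgerSymmetricFamilyProofs`, class `3`, auxiliary index `3`):
**`a_{G_D}(3) = a_{G_3}(D)`** for square-free `D ≡ 3 (mod 8)` (`qCoeffs_kohnenFamily_symm_three`,
by `Shintani32KohnenGenusTriviality.kohnenWt_eq_kohnenWt_three`); `kohnenFamily_mem`.

No named facts; definitions `actR`, `actDual`, `actREquiv`, `transSum`, `transWt`, `kohnenLift`,
`kohnenExp`, `kohnenFamily`, `orbDatum`.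
-/

noncomputable section

open Complex Real MeasureTheory Filter
open scoped MatrixGroups ModularForm Modular Topology

namespace Literature.NumberTheory.EllipticCurves.Shintani

open UpperHalfPlane hiding I
open CongruenceSubgroup ModularGroup MulAction
open Literature.NumberTheory.EllipticCurves.ModularForms

/-! ### The simultaneous action of `Γ₀(32)` on residues and on dual coordinates -/

section TransWeight

/-- The coordinate action `[32r₀, r₁, r₂] ↦ [32r₀, r₁, r₂] ∘ g`, `g = (a b; 32c' d)`, on residues. [folklore] -/
def actR {M : ℕ} (a b c' d : ℤ) (r : Fin 3 → ZMod M) : Fin 3 → ZMod M :=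
  ![r 0 * (a : ZMod M) ^ 2 + r 1 * a * c' + 32 * r 2 * (c' : ZMod M) ^ 2,
    64 * r 0 * a * b + r 1 * (a * d + 32 * b * c') + 64 * r 2 * c' * d,
    32 * r 0 * (b : ZMod M) ^ 2 + r 1 * b * d + r 2 * (d : ZMod M) ^ 2]

/-- The action on dual coordinates: `[32v₀, 64v₁, v₂] ∘ g = [32v₀', 64v₁', v₂']`. [folklore] -/
def actDual (a b c' d : ℤ) (v : Fin 3 → ℤ) : Fin 3 → ℤ :=
  ![v 0 * a ^ 2 + 64 * v 1 * a * c' + 32 * v 2 * c' ^ 2,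
    v 0 * a * b + v 1 * (a * d + 32 * b * c') + v 2 * c' * d,
    32 * v 0 * b ^ 2 + 64 * v 1 * b * d + v 2 * d ^ 2]

/-- `embed32 ∘ actDual = actSharp32 ∘ embed32`. [folklore] -/
theorem embed32_actDual (a b c' d : ℤ) (v : Fin 3 → ℤ) :
    embed32 (actDual a b c' d v) = actSharp32 a b c' d (embed32 v) := by
  funext i
  fin_cases i <;> simp only [embed32, actDual, actSharp32, Matrix.cons_val_zero, Matrix.cons_val_one,
    Matrix.cons_val] <;> ring

/-- `actR` is the reduction of `actSharp32`. [folklore] -/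
theorem actR_intCast {M : ℕ} (a b c' d : ℤ) (k : Fin 3 → ℤ) :
    actR a b c' d (fun i ↦ (k i : ZMod M)) = fun i ↦ ((actSharp32 a b c' d k i : ℤ) : ZMod M) := by
  funext i
  fin_cases i <;> simp [actR, actSharp32]

/-- `Δ` is invariant: `Δ(r ∘ g) = Δ(r)` (`det g = 1`). [folklore] -/
theorem nZK_actR {M : ℕ} {a b c' d : ℤ} (hdet : a * d - 32 * b * c' = 1) (r : Fin 3 → ZMod M) :
    nZK (actR a b c' d r) = nZK r := by
  have hdetM : (a : ZMod M) * d - 32 * b * c' = 1 := by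
    have := congrArg (fun x : ℤ ↦ (x : ZMod M)) hdet
    push_cast at this
    exact this
  simp only [nZK, actR, Matrix.cons_val_zero, Matrix.cons_val_one, Matrix.cons_val]
  linear_combination ((r 1 ^ 2 - 128 * r 0 * r 2) * ((a : ZMod M) * d - 32 * b * c' + 1)) * hdetM

/-- The pairing `ℓ` is invariant under the simultaneous action (`det g = 1`). [folklore] -/
theorem ellZ_actR_actDual {M : ℕ} {a b c' d : ℤ} (hdet : a * d - 32 * b * c' = 1)
    (r : Fin 3 → ZMod M) (v : Fin 3 → ℤ) :
    ellZ (actR a b c' d r) (actDual a b c' d v) = ellZ r v := by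
  have hdetM : (a : ZMod M) * d - 32 * b * c' = 1 := by
    have := congrArg (fun x : ℤ ↦ (x : ZMod M)) hdet
    push_cast at this
    exact this
  simp only [ellZ, actR, actDual, Matrix.cons_val_zero, Matrix.cons_val_one, Matrix.cons_val]
  push_cast
  linear_combination ((-(r 0 * (v 2 : ZMod M)) + r 1 * (v 1 : ZMod M) - r 2 * (v 0 : ZMod M)) *
    ((a : ZMod M) * d - 32 * b * c' + 1)) * hdetM

/-- Composition of the residue actions. [folklore] -/
theorem actR_actR {M : ℕ} (a b c' d a₁ b₁ c₁' d₁ : ℤ) (r : Fin 3 → ZMod M) :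
    actR a b c' d (actR a₁ b₁ c₁' d₁ r) =
      actR (a₁ * a + 32 * b₁ * c') (a₁ * b + b₁ * d) (c₁' * a + d₁ * c') (32 * c₁' * b + d₁ * d) r := by
  funext i
  fin_cases i <;> simp [actR] <;> ring

/-- `actR 1 0 0 1 = id`. [folklore] -/
theorem actR_one {M : ℕ} (r : Fin 3 → ZMod M) : actR 1 0 0 1 r = r := by
  funext i
  fin_cases i <;> simp [actR]

/-- `actR_congr` (auxiliary): equal parameters give equal actions. [folklore] -/
theorem actR_congr {M : ℕ} {a b c' d a₁ b₁ c₁' d₁ : ℤ} (ha : a = a₁) (hb : b = b₁) (hc : c' = c₁') (hd : d = d₁)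
    (r : Fin 3 → ZMod M) : actR a b c' d r = actR a₁ b₁ c₁' d₁ r := by
  subst ha hb hc hd; rfl

/-- `r ↦ r ∘ g` is a bijection of `(ℤ/M)³` (`det g = 1`). [folklore] -/
def actREquiv {M : ℕ} (a b c' d : ℤ) (hdet : a * d - 32 * b * c' = 1) :
    (Fin 3 → ZMod M) ≃ (Fin 3 → ZMod M) where
  toFun := actR a b c' d
  invFun := actR d (-b) (-c') a
  left_inv r := by
    rw [actR_actR]
    rw [actR_congr (a₁ := 1) (b₁ := 0) (c₁' := 0) (d₁ := 1) (by linear_combination hdet) (by ring) (by ring)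
      (by linear_combination hdet), actR_one]
  right_inv r := by
    rw [actR_actR]
    rw [actR_congr (a₁ := 1) (b₁ := 0) (c₁' := 0) (d₁ := 1) (by linear_combination hdet) (by ring) (by ring)
      (by linear_combination hdet), actR_one]

variable (D : ℕ)

/-- `w_D` is invariant under the residue action (`D ∣ M`, `D` odd). [folklore] -/
theorem wDK_actR {M : ℕ} [NeZero M] (hDM : D ∣ M) (hD : Odd D) {a b c' d : ℤ}
    (hdet : a * d - 32 * b * c' = 1) (r : Fin 3 → ZMod M) :
    wDK D (actR a b c' d r) = wDK D r := by
  have hr : r = fun i ↦ ((liftZ r i : ℤ) : ZMod M) := by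
    funext i; rw [liftZ, Int.cast_natCast, ZMod.natCast_zmod_val]
  conv_lhs => rw [hr, actR_intCast]
  conv_rhs => rw [hr]
  rw [← kohnenWt_eq_wDK hDM, ← kohnenWt_eq_wDK hDM]
  have h := invWeight32_kohnenWt hD a b c' d hdet (liftZ r)
  simp only at h
  exact_mod_cast h

/-- **The transformed weight on dual coordinates**:
`S(v) = ∑_{r ∈ (ℤ/N)³} w_D(r) ψ_N(a₀ Δ(r) + ℓ(r, v))`. [folklore] -/
def transSum (N : ℕ) [NeZero N] (a₀ : ℤ) (v : Fin 3 → ℤ) : ℂ :=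
  ∑ r : Fin 3 → ZMod N, wDK D r * ZMod.stdAddChar ((a₀ : ZMod N) * nZK r + ellZ r v)

/-- **Invariance of the transformed weight** under `v ↦ v ∘ g` (`D ∣ N`, `D` odd). [folklore] -/
theorem transSum_actDual {N : ℕ} [NeZero N] (hDN : D ∣ N) (hD : Odd D) (a₀ : ℤ) {a b c' d : ℤ}
    (hdet : a * d - 32 * b * c' = 1) (v : Fin 3 → ℤ) :
    transSum D N a₀ (actDual a b c' d v) = transSum D N a₀ v := by
  unfold transSum
  refine Fintype.sum_equiv (actREquiv a b c' d hdet).symm _ _ fun r ↦ ?_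
  -- `r = actR (e.symm r)`
  set r' := (actREquiv (M := N) a b c' d hdet).symm r with hr'
  have hr : r = actR a b c' d r' := ((actREquiv (M := N) a b c' d hdet).apply_symm_apply r).symm
  rw [hr, wDK_actR D hDN hD hdet, nZK_actR hdet, ellZ_actR_actDual hdet]

/-- **The transformed weight on `L♮₃₂`-coordinates**: `S̃(k) = S(k₀, k₁/64, k₂)` if `64 ∣ k₁`, else `0`.
[folklore] -/
def transWt (N : ℕ) [NeZero N] (a₀ : ℤ) (k : Fin 3 → ℤ) : ℂ :=
  if (64 : ℤ) ∣ k 1 then transSum D N a₀ (vOf32 k) else 0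

/-- `transWt_embed32` (auxiliary). [folklore] -/
theorem transWt_embed32 (N : ℕ) [NeZero N] (a₀ : ℤ) (v : Fin 3 → ℤ) :
    transWt D N a₀ (embed32 v) = transSum D N a₀ v := by
  have h64 : (64 : ℤ) ∣ embed32 v 1 := ⟨v 1, by simp [embed32]⟩
  rw [transWt, if_pos h64]
  congr 1
  funext i
  fin_cases i <;> simp [vOf32, embed32]

/-- `transWt_of_not_dvd` (auxiliary). [folklore] -/
theorem transWt_of_not_dvd (N : ℕ) [NeZero N] (a₀ : ℤ) {k : Fin 3 → ℤ} (h : ¬ (64 : ℤ) ∣ k 1) :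
    transWt D N a₀ k = 0 := by
  rw [transWt, if_neg h]

/-- **The transformed weight is `Γ₀(32)`-invariant.** [folklore] -/
theorem invWeight32_transWt {N : ℕ} [NeZero N] (hDN : D ∣ N) (hD : Odd D) (a₀ : ℤ) :
    InvWeight32 (transWt D N a₀) := by
  intro a b c' d hdet k
  by_cases h64 : (64 : ℤ) ∣ k 1
  · obtain ⟨v1, hv1⟩ := h64
    have hk : k = embed32 ![k 0, v1, k 2] := by
      funext i; fin_cases i <;> simp [embed32, hv1]
    rw [hk, ← embed32_actDual, transWt_embed32, transWt_embed32, transSum_actDual D hDN hD a₀ hdet]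
  · rw [transWt_of_not_dvd D N a₀ h64,
      transWt_of_not_dvd D N a₀ (fun h ↦ h64 ((dvd_actSharp32_one_iff hdet k).mp h))]

/-- **The transformed weight is bounded** (by `N³`). [folklore] -/
theorem bddWeight_transWt (N : ℕ) [NeZero N] (a₀ : ℤ) : BddWeight (transWt D N a₀) := by
  refine ⟨(Fintype.card (Fin 3 → ZMod N) : ℝ), fun k ↦ ?_⟩
  unfold transWt
  split_ifs with h
  · unfold transSum
    refine (norm_sum_le _ _).trans ?_
    have : ∀ r : Fin 3 → ZMod N,
        ‖wDK D r * ZMod.stdAddChar ((a₀ : ZMod N) * nZK r + ellZ r (vOf32 k))‖ ≤ 1 := fun r ↦ by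
      rw [norm_mul, AddChar.norm_apply, mul_one]; exact norm_wDK_le D r
    calc ∑ r : Fin 3 → ZMod N, ‖wDK D r * ZMod.stdAddChar ((a₀ : ZMod N) * nZK r + ellZ r (vOf32 k))‖
        ≤ ∑ _r : Fin 3 → ZMod N, (1 : ℝ) := Finset.sum_le_sum fun r _ ↦ this r
      _ = _ := by simp
  · rw [norm_zero]; positivity

end TransWeight

/-! ### The kernel at `g z` as a generic kernel at `ζ = z + d/c` -/

section KernelAtCusp

variable (D : ℕ) [NeZero D]

/-- The phase of the Gauss coefficient moves the small-scale point: `d/(16384N) + z/(16384D) = (z + d/c)/(16384D)`.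
[folklore] -/
theorem vadd_ptSmall (c : ℕ) [NeZero c] (d : ℤ) (z : ℍ) :
    ((d / (16384 * (c * D : ℕ)) : ℝ)) +ᵥ ptSmall D z = ptSmall D (((d / c : ℝ)) +ᵥ z) := by
  apply UpperHalfPlane.ext
  simp only [UpperHalfPlane.coe_vadd, coe_mulPos]
  have hc : (c : ℂ) ≠ 0 := by exact_mod_cast NeZero.ne c
  have hD : (D : ℂ) ≠ 0 := by exact_mod_cast NeZero.ne D
  push_cast
  field_simp

/-- The Gauss coefficient times `f` at the small scale is the transformed weight times `f` at `ζ`.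
[folklore] -/
theorem gaussCoefK_mul_shintaniFn (a d : ℤ) (c : ℕ) [NeZero c] (w z : ℍ) (v : Fin 3 → ℤ) :
    gaussCoefK D a d c v * shintaniFn w (ptSmall D z) (latFun32 v) =
      transSum D (c * D) a v * shintaniFn w (ptSmall D (((d / c : ℝ)) +ᵥ z)) (latFun32 v) := by
  rw [gaussCoefK, ← vadd_ptSmall D c d z, shintaniFn_vadd, eR, transSum]
  have : (2 * π * I * ((d * disc (latFun32 v) / (16384 * (c * D : ℕ)) : ℝ) : ℂ)) =
      2 * π * I * (((d / (16384 * (c * D : ℕ)) : ℝ) : ℂ) * disc (latFun32 v)) := by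
    push_cast; ring
  rw [this]
  ring

omit [NeZero D] in
/-- A series of the transformed weights against `ι₃₂` is the series of `S̃` against `ι♮₃₂`. [folklore] -/
theorem tsum_transSum_mul (N : ℕ) [NeZero N] (a₀ : ℤ) (F : V → ℂ) :
    ∑' v : Fin 3 → ℤ, transSum D N a₀ v * F (latFun32 v) =
      ∑' k : Fin 3 → ℤ, transWt D N a₀ k * F (latSharp32 k) := by
  have hsupp : Function.support (fun k : Fin 3 → ℤ ↦ transWt D N a₀ k * F (latSharp32 k)) ⊆ Set.range embed32 := by
    intro k hk
    rw [Function.mem_support] at hk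
    by_cases h : (64 : ℤ) ∣ k 1
    · obtain ⟨k1, hk1⟩ := h
      exact ⟨![k 0, k1, k 2], by funext i; fin_cases i <;> simp [embed32, hk1]⟩
    · exact absurd (by rw [transWt_of_not_dvd D N a₀ h, zero_mul]) hk
  symm
  rw [← tsum_subtype_eq_of_support_subset hsupp, ← (Equiv.ofInjective embed32 embed32_injective).tsum_eq]
  refine tsum_congr fun v ↦ ?_
  simp only [Equiv.ofInjective_apply]
  rw [transWt_embed32, latSharp32_embed32]

/-- **The kernel at `g z`** (`g = (a b; c d)`, `c ≥ 1`, `N = cD`, `ζ = z + d/c`):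
`𝒦_D(w, gz) = (Im gz)^{1/2} (32N³)⁻¹ κ(Z') (64N)⁻¹ · (Im z)^{-1/2} 𝒦₃₂[S̃_g, 1/(16384D)](w, ζ)`.
[cite: Shintani1975, Prop. 1.6] -/
theorem kerK_smul_eq_genKernel32 (γ : SL(2, ℤ)) (c : ℕ) [NeZero c] (hc : (γ 1 0 : ℤ) = c) (w z : ℍ) :
    kerK D w (γ • z) = (Real.sqrt (γ • z).im : ℂ) *
      ((((32 * ((c * D : ℕ) : ℝ) ^ 3)⁻¹ : ℝ) : ℂ) * kappa (invFour (auxWK (c * D) c (γ 1 1) z)) *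
        (((64 * (c * D : ℕ) : ℝ) : ℂ))⁻¹) *
      (((Real.sqrt z.im : ℂ))⁻¹ *
        genKernel32 (transWt D (c * D) (γ 0 0)) (1 / (16384 * D)) (scaleSmall_pos D) w
          ((((γ 1 1 : ℤ) / c : ℝ)) +ᵥ z)) := by
  rw [kerK_smul D γ c hc w z]
  congr 1
  simp_rw [gaussCoefK_mul_shintaniFn]
  rw [tsum_transSum_mul, genKernel32]
  have him : ((((γ 1 1 : ℤ) / c : ℝ)) +ᵥ z).im = z.im := UpperHalfPlane.vadd_im _ _
  rw [him]
  have hz : (Real.sqrt z.im : ℂ) ≠ 0 := by exact_mod_cast (Real.sqrt_pos.mpr z.im_pos).ne'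
  rw [← mul_assoc, inv_mul_cancel₀ hz, one_mul]

end KernelAtCusp

/-! ### The lift at `g z` and the cusp conditions -/

section Cusp

variable (D : ℕ) [NeZero D]

/-- **The Kohnen-type lift** `Φ_D = Φ[χ_{D*}, 1/D]` of a function on `ℍ`. [cite: Shintani1975, §2 (2.1)] -/
def kohnenLift (φ : ℍ → ℂ) (z : ℍ) : ℂ := liftG (fun k ↦ (kohnenWt D k : ℂ)) (1 / D) (scaleK_pos D) φ z

/-- `Φ_D(z) = ∫_F φ(w) 𝒦_D(w, z)`. [folklore] -/
theorem kohnenLift_eq (φ : ℍ → ℂ) (z : ℍ) : kohnenLift D φ z = ∫ w in liftDomain32, φ w * kerK D w z := rfl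

/-- **The lift at `g z`**: `Φ_D(gz) = (Im gz)^{1/2} (32N³)⁻¹ κ(Z') (64N)⁻¹ (Im z)^{-1/2} · Φ[S̃_g, 1/(16384D)](z + d/c)`.
[cite: Shintani1975, §2, Prop. 2.4] -/
theorem kohnenLift_smul (φ : ℍ → ℂ) (γ : SL(2, ℤ)) (c : ℕ) [NeZero c] (hc : (γ 1 0 : ℤ) = c) (z : ℍ) :
    kohnenLift D φ (γ • z) = (Real.sqrt (γ • z).im : ℂ) *
      ((((32 * ((c * D : ℕ) : ℝ) ^ 3)⁻¹ : ℝ) : ℂ) * kappa (invFour (auxWK (c * D) c (γ 1 1) z)) *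
        (((64 * (c * D : ℕ) : ℝ) : ℂ))⁻¹) * ((Real.sqrt z.im : ℂ))⁻¹ *
      liftG (transWt D (c * D) (γ 0 0)) (1 / (16384 * D)) (scaleSmall_pos D) φ ((((γ 1 1 : ℤ) / c : ℝ)) +ᵥ z) := by
  unfold kohnenLift liftG
  have hK : ∀ w, genKernel32 (fun k ↦ (kohnenWt D k : ℂ)) (1 / D) (scaleK_pos D) w (γ • z) = kerK D w (γ • z) :=
    fun w ↦ rfl
  simp_rw [hK, kerK_smul_eq_genKernel32 D γ c hc]
  rw [← integral_const_mul]
  congr 1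
  funext w
  ring

/-- **`|κ(Z')|`** for `Z' = -1/(N(cz+d))`: `|κ(Z')| = (N|cz+d|)^{5/2}/(8√2)`, stated as
`|κ(Z')| · 8√2 = (N |cz + d|)² √(N|cz+d|)`. [folklore] -/
theorem norm_kappa_invFour_auxWK (N c : ℕ) [NeZero N] [NeZero c] (d : ℤ) (z : ℍ) :
    ‖kappa (invFour (auxWK N c d z))‖ * (8 * Real.sqrt 2) =
      ((N : ℝ) * ‖(c : ℂ) * z + d‖) ^ 2 * Real.sqrt ((N : ℝ) * ‖(c : ℂ) * z + d‖) := by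
  set Z : ℍ := invFour (auxWK N c d z) with hZ
  have hcz : (c : ℂ) * z + d ≠ 0 := by
    have := im_denom_pos (c := c) d z
    intro h; rw [h] at this; simp at this
  have hN0 : (0 : ℝ) < N := by exact_mod_cast Nat.pos_of_ne_zero (NeZero.ne N)
  have hcoe : ((Z : ℍ) : ℂ) = -1 / (N * ((c : ℂ) * z + d)) := coe_invFour_auxWK N c d z
  have hnZ : ‖((Z : ℍ) : ℂ)‖ = 1 / ((N : ℝ) * ‖(c : ℂ) * z + d‖) := by
    rw [hcoe, norm_div, norm_neg, norm_one, norm_mul, Complex.norm_natCast]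
  have hZ0 : ((Z : ℍ) : ℂ) ≠ 0 := UpperHalfPlane.ne_zero Z
  have hnZpos : 0 < ‖((Z : ℍ) : ℂ)‖ := norm_pos_iff.mpr hZ0
  -- norms of the Gaussian parameters
  have hS : ‖aS Z‖ = 4 * ‖((Z : ℍ) : ℂ)‖ := by
    rw [aS, norm_mul, norm_mul, Complex.norm_I, Complex.norm_conj]; norm_num
  have hB : ‖aB Z‖ = 2 * ‖((Z : ℍ) : ℂ)‖ := by
    rw [aB, norm_mul, norm_mul, norm_neg, Complex.norm_I]; norm_num
  have hT : ‖aT Z‖ = 4 * ‖((Z : ℍ) : ℂ)‖ := by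
    rw [aT, norm_mul, norm_mul, norm_neg, Complex.norm_I]; norm_num
  have hcp : ∀ u : ℂ, u ≠ 0 → ‖u ^ (1 / 2 : ℂ)‖ = Real.sqrt ‖u‖ := by
    intro u hu
    rw [Complex.norm_cpow_of_ne_zero hu, Real.sqrt_eq_rpow]
    simp
  have hS0 : aS Z ≠ 0 := by
    intro h; have := congrArg norm h; rw [hS, norm_zero] at this; linarith
  have hB0 : aB Z ≠ 0 := by
    intro h; have := congrArg norm h; rw [hB, norm_zero] at this; linarith
  have hT0 : aT Z ≠ 0 := by
    intro h; have := congrArg norm h; rw [hT, norm_zero] at this; linarith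
  rw [kappa, norm_mul, norm_mul, norm_mul, norm_div, norm_div, norm_div, norm_div, norm_one, norm_mul,
    Complex.norm_two, hcp _ hS0, hcp _ hB0, hcp _ hT0, hS, hB, hT]
  set m : ℝ := ‖((Z : ℍ) : ℂ)‖ with hm
  have hM : (N : ℝ) * ‖(c : ℂ) * z + d‖ = 1 / m := by rw [hnZ, one_div_one_div]
  rw [hM]
  set s : ℝ := Real.sqrt m with hs
  have hs0 : 0 < s := Real.sqrt_pos.mpr hnZpos
  have hms : m = s ^ 2 := (Real.sq_sqrt hnZpos.le).symm
  have h4 : Real.sqrt (4 * m) = 2 * s := by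
    rw [Real.sqrt_mul (by norm_num), show (4 : ℝ) = 2 ^ 2 by norm_num, Real.sqrt_sq (by norm_num)]
  have h2 : Real.sqrt (2 * m) = Real.sqrt 2 * s := Real.sqrt_mul (by norm_num) _
  have h1 : Real.sqrt (1 / m) = 1 / s := by rw [Real.sqrt_div' _ hnZpos.le, Real.sqrt_one]
  rw [h4, h2, h1, hms]
  have hs2 : (0 : ℝ) < Real.sqrt 2 := Real.sqrt_pos.mpr (by norm_num)
  field_simp
  ring

/-- The bound on `Φ_D(gz)` for `c ≥ 1` and `Im z ≥ 1`. [folklore] -/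
theorem norm_kohnenLift_smul_le (hD : Odd D) (f : CuspForm (Gamma0 32) 2) (γ : SL(2, ℤ)) (c : ℕ) [NeZero c]
    (hc : (γ 1 0 : ℤ) = c) :
    ∃ C : ℝ, 0 ≤ C ∧ ∀ z : ℍ, 1 ≤ z.im →
      ‖kohnenLift D f (γ • z)‖ ≤ C * ‖(c : ℂ) * z + (γ 1 1 : ℤ)‖ ^ (3 / 2 : ℝ) * Real.sqrt z.im *
        Real.exp (-(2 * π * (1 / (16384 * D)) * (z.im - 1))) := by
  set N : ℕ := c * D with hN
  set cw := transWt D (c * D) (γ 0 0) with hcw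
  have hinv : InvWeight32 cw := invWeight32_transWt D (dvd_mul_left D c) hD (γ 0 0)
  have hb : BddWeight cw := bddWeight_transWt D (c * D) (γ 0 0)
  set t : ℝ := 1 / (16384 * D) with ht
  have htpos : 0 < t := scaleSmall_pos D
  -- the decay constant of the transformed lift at height `1`
  set C₁ : ℝ := ∑' k : Fin 3 → ℤ, ∫ w in liftDomain32, ‖liftTermG cw t htpos f UpperHalfPlane.I k w‖ with hC₁
  have hC₁0 : 0 ≤ C₁ := tsum_nonneg fun _ ↦ integral_nonneg fun _ ↦ norm_nonneg _
  have hN0 : (0 : ℝ) < (c * D : ℕ) := by exact_mod_cast Nat.pos_of_ne_zero (NeZero.ne (c * D))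
  set K : ℝ := (32 * ((c * D : ℕ) : ℝ) ^ 3)⁻¹ * (64 * (c * D : ℕ) : ℝ)⁻¹ * (((c * D : ℕ) : ℝ) ^ 2 *
    Real.sqrt ((c * D : ℕ) : ℝ) / (8 * Real.sqrt 2)) with hK
  have hK0 : 0 ≤ K := by rw [hK]; positivity
  refine ⟨K * C₁, mul_nonneg hK0 hC₁0, fun z hz ↦ ?_⟩
  have hI : UpperHalfPlane.I.im = 1 := rfl
  set ζ : ℍ := ((((γ 1 1 : ℤ) / c : ℝ)) +ᵥ z) with hζ
  have hζim : ζ.im = z.im := UpperHalfPlane.vadd_im _ _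
  have hdecay := norm_liftG_le t htpos hinv hb f UpperHalfPlane.I ζ (by rw [hζim, hI]; exact hz)
  rw [hζim, hI] at hdecay
  rw [kohnenLift_smul D f γ c hc z]
  -- norms of the prefactors
  have hcz : (c : ℂ) * z + (γ 1 1 : ℤ) ≠ 0 := by
    have := im_denom_pos (c := c) (γ 1 1) z
    intro h; rw [h] at this; simp at this
  set A : ℝ := ‖(c : ℂ) * z + (γ 1 1 : ℤ)‖ with hA
  have hA0 : 0 < A := norm_pos_iff.mpr hcz
  have him : (γ • z).im = z.im / A ^ 2 := by
    rw [ModularGroup.im_smul_eq_div_normSq, ModularGroup.denom_apply, hc, hA, Complex.normSq_eq_norm_sq]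
    push_cast; rfl
  have hsqrt_im : ‖(Real.sqrt (γ • z).im : ℂ)‖ = Real.sqrt z.im / A := by
    rw [Complex.norm_real, Real.norm_of_nonneg (Real.sqrt_nonneg _), him, Real.sqrt_div' _ (sq_nonneg A),
      Real.sqrt_sq hA0.le]
  have hκ := norm_kappa_invFour_auxWK (c * D) c (γ 1 1) z
  rw [← hA] at hκ
  have hs2 : (0 : ℝ) < 8 * Real.sqrt 2 := by positivity
  have hκ' : ‖kappa (invFour (auxWK (c * D) c (γ 1 1) z))‖ =
      (((c * D : ℕ) : ℝ) * A) ^ 2 * Real.sqrt (((c * D : ℕ) : ℝ) * A) / (8 * Real.sqrt 2) := by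
    rw [eq_div_iff hs2.ne', hκ]
  have hpref : ‖(((32 * ((c * D : ℕ) : ℝ) ^ 3)⁻¹ : ℝ) : ℂ) * kappa (invFour (auxWK (c * D) c (γ 1 1) z)) *
        (((64 * (c * D : ℕ) : ℝ) : ℂ))⁻¹‖ = K * (A ^ 2 * Real.sqrt A) := by
    rw [norm_mul, norm_mul, norm_inv, Complex.norm_real, Complex.norm_real, hκ',
      Real.norm_of_nonneg (by positivity), Real.norm_of_nonneg (by positivity), hK,
      Real.sqrt_mul hN0.le]
    ring
  have hinvsqrt : ‖((Real.sqrt z.im : ℂ))⁻¹‖ = (Real.sqrt z.im)⁻¹ := by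
    rw [norm_inv, Complex.norm_real, Real.norm_of_nonneg (Real.sqrt_nonneg _)]
  have hy0 : 0 < Real.sqrt z.im := Real.sqrt_pos.mpr z.im_pos
  rw [norm_mul, norm_mul, norm_mul, hsqrt_im, hpref, hinvsqrt]
  have hA32 : A ^ (3 / 2 : ℝ) = A * Real.sqrt A := by
    rw [show (3 / 2 : ℝ) = 1 + 1 / 2 by norm_num, Real.rpow_add hA0, Real.rpow_one, Real.sqrt_eq_rpow]
  rw [hA32]
  calc Real.sqrt z.im / A * (K * (A ^ 2 * Real.sqrt A)) * (Real.sqrt z.im)⁻¹ *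
        ‖liftG cw t htpos (⇑f) ζ‖
      = K * (A * Real.sqrt A) * ‖liftG cw t htpos (⇑f) ζ‖ := by field_simp
    _ ≤ K * (A * Real.sqrt A) * (Real.sqrt z.im * Real.exp (-(2 * π * t * (z.im - 1))) * C₁) :=
        mul_le_mul_of_nonneg_left hdecay (by positivity)
    _ = K * C₁ * (A * Real.sqrt A) * Real.sqrt z.im * Real.exp (-(2 * π * (1 / (16384 * D)) * (z.im - 1))) := by
        rw [ht]; ring

/-- `x^{3} · e^{-a x}`-type decay: `y e^{-κ(y-1)} → 0`. [folklore] -/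
theorem tendsto_mul_exp_neg (κ : ℝ) (hκ : 0 < κ) :
    Tendsto (fun y : ℝ ↦ y * Real.exp (-(κ * (y - 1)))) atTop (𝓝 0) := by
  have h := (Real.tendsto_pow_mul_exp_neg_atTop_nhds_zero 1).comp (tendsto_id.const_mul_atTop hκ)
  have h2 : Tendsto (fun y : ℝ ↦ (Real.exp κ / κ) * ((κ * y) ^ 1 * Real.exp (-(κ * y)))) atTop (𝓝 0) := by
    simpa using h.const_mul (Real.exp κ / κ)
  refine h2.congr fun y ↦ ?_
  rw [pow_one, show -(κ * (y - 1)) = κ + -(κ * y) by ring, Real.exp_add]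
  field_simp

/-- **The cusp condition at `g` with `c_g ≥ 1`.** [cite: Shintani1975, §2, Prop. 2.4] -/
theorem isZeroAtImInfty_slashSq_kohnenLift_of_pos (hD : Odd D) (f : CuspForm (Gamma0 32) 2) (γ : SL(2, ℤ))
    (c : ℕ) [NeZero c] (hc : (γ 1 0 : ℤ) = c) :
    IsZeroAtImInfty (slashSq 3 (kohnenLift D f) γ) := by
  obtain ⟨C, hC0, hC⟩ := norm_kohnenLift_smul_le D hD f γ c hc
  set κ : ℝ := 4 * π * (1 / (16384 * D)) with hκ
  have hκ0 : 0 < κ := by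
    have := scaleSmall_pos D; rw [hκ]; positivity
  have hlim := (tendsto_mul_exp_neg κ hκ0).const_mul (C ^ 2)
  rw [mul_zero] at hlim
  rw [UpperHalfPlane.isZeroAtImInfty_iff]
  intro ε hε
  have hev := hlim.eventually (gt_mem_nhds hε)
  obtain ⟨A₀, hA₀⟩ := Filter.eventually_atTop.mp hev
  refine ⟨max A₀ 1, fun z hz ↦ ?_⟩
  have hz1 : 1 ≤ z.im := le_trans (le_max_right _ _) hz
  have hzA : A₀ ≤ z.im := le_trans (le_max_left _ _) hz
  have hb := hC z hz1
  have hden : denom γ z = (c : ℂ) * z + (γ 1 1 : ℤ) := by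
    rw [ModularGroup.denom_apply, hc]; push_cast; rfl
  have hcz : (c : ℂ) * z + (γ 1 1 : ℤ) ≠ 0 := by
    have := im_denom_pos (c := c) (γ 1 1) z
    intro h; rw [h] at this; simp at this
  set A : ℝ := ‖(c : ℂ) * z + (γ 1 1 : ℤ)‖ with hA
  have hA0 : 0 < A := norm_pos_iff.mpr hcz
  rw [norm_slashSq, hden, ← hA]
  have hA3 : A ^ 3 = (A ^ (3 / 2 : ℝ)) ^ 2 := by
    rw [← Real.rpow_natCast, ← Real.rpow_mul_natCast hA0.le]; norm_num
  have key : ‖kohnenLift D f (γ • z)‖ ^ 2 / A ^ 3 ≤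
      C ^ 2 * (z.im * Real.exp (-(κ * (z.im - 1)))) := by
    rw [div_le_iff₀ (pow_pos hA0 3), hA3]
    have h2 := mul_self_le_mul_self (norm_nonneg _) hb
    have hexp2 : Real.exp (-(2 * π * (1 / (16384 * D)) * (z.im - 1))) ^ 2 = Real.exp (-(κ * (z.im - 1))) := by
      rw [← Real.exp_nat_mul, hκ]; congr 1; push_cast; ring
    have hsq : Real.sqrt z.im ^ 2 = z.im := Real.sq_sqrt z.im_pos.le
    calc ‖kohnenLift D f (γ • z)‖ ^ 2 = ‖kohnenLift D f (γ • z)‖ * ‖kohnenLift D f (γ • z)‖ := sq _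
      _ ≤ (C * A ^ (3 / 2 : ℝ) * Real.sqrt z.im * Real.exp (-(2 * π * (1 / (16384 * D)) * (z.im - 1)))) *
          (C * A ^ (3 / 2 : ℝ) * Real.sqrt z.im * Real.exp (-(2 * π * (1 / (16384 * D)) * (z.im - 1)))) := h2
      _ = (Real.sqrt z.im) ^ 2 * (Real.exp (-(2 * π * (1 / (16384 * D)) * (z.im - 1)))) ^ 2 * C ^ 2 *
          (A ^ (3 / 2 : ℝ)) ^ 2 := by ring
      _ = C ^ 2 * (z.im * Real.exp (-(κ * (z.im - 1)))) * (A ^ (3 / 2 : ℝ)) ^ 2 := by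
          rw [hexp2, hsq]; ring
  exact key.trans (hA₀ z.im hzA).le

/-- **The cusp condition at `g` with `c_g = 0`** (then `g • z = z + n`): directly from the decay of
`Φ_D` itself. [cite: Shintani1975, §2, Prop. 2.4] -/
theorem isZeroAtImInfty_slashSq_kohnenLift_of_zero (hD : Odd D) (f : CuspForm (Gamma0 32) 2) (γ : SL(2, ℤ))
    (hc : (γ 1 0 : ℤ) = 0) :
    IsZeroAtImInfty (slashSq 3 (kohnenLift D f) γ) := by
  set cw : (Fin 3 → ℤ) → ℂ := fun k ↦ (kohnenWt D k : ℂ) with hcw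
  have hinv : InvWeight32 cw := invWeight32_kohnenWt hD
  have hb : BddWeight cw := bddWeight_kohnenWt D
  set t : ℝ := 1 / D with ht
  have htpos : 0 < t := scaleK_pos D
  set C₁ : ℝ := ∑' k : Fin 3 → ℤ, ∫ w in liftDomain32, ‖liftTermG cw t htpos f UpperHalfPlane.I k w‖ with hC₁
  have hC₁0 : 0 ≤ C₁ := tsum_nonneg fun _ ↦ integral_nonneg fun _ ↦ norm_nonneg _
  -- `d = ±1`, `|denom| = 1`, `Im (γ z) = Im z`
  have hdet := det_eq_one' γ
  rw [hc] at hdet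
  have had : (γ 0 0 : ℤ) * γ 1 1 = 1 := by linear_combination hdet
  set κ : ℝ := 4 * π * t with hκ
  have hκ0 : 0 < κ := by rw [hκ]; positivity
  have hlim := (tendsto_mul_exp_neg κ hκ0).const_mul (C₁ ^ 2)
  rw [mul_zero] at hlim
  rw [UpperHalfPlane.isZeroAtImInfty_iff]
  intro ε hε
  have hev := hlim.eventually (gt_mem_nhds hε)
  obtain ⟨A₀, hA₀⟩ := Filter.eventually_atTop.mp hev
  refine ⟨max A₀ 1, fun z hz ↦ ?_⟩
  have hz1 : 1 ≤ z.im := le_trans (le_max_right _ _) hz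
  have hzA : A₀ ≤ z.im := le_trans (le_max_left _ _) hz
  have hden1 : ‖denom γ z‖ = 1 := by
    rw [ModularGroup.denom_apply, hc]; push_cast; rw [zero_mul, zero_add, Complex.norm_intCast]
    rcases Int.eq_one_or_neg_one_of_mul_eq_one' had with ⟨-, h⟩ | ⟨-, h⟩ <;> simp [h]
  have him : (γ • z).im = z.im := by
    rw [ModularGroup.im_smul_eq_div_normSq, Complex.normSq_eq_norm_sq, hden1]; simp
  have hI : UpperHalfPlane.I.im = 1 := rfl
  have hdecay := norm_liftG_le t htpos hinv hb f UpperHalfPlane.I (γ • z) (by rw [him, hI]; exact hz1)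
  rw [him, hI] at hdecay
  have hΦ : kohnenLift D f (γ • z) = liftG cw t htpos f (γ • z) := rfl
  rw [norm_slashSq, hden1, one_pow, div_one, hΦ]
  have hexp2 : Real.exp (-(2 * π * t * (z.im - 1))) ^ 2 = Real.exp (-(κ * (z.im - 1))) := by
    rw [← Real.exp_nat_mul, hκ]; congr 1; push_cast; ring
  have hsq : Real.sqrt z.im ^ 2 = z.im := Real.sq_sqrt z.im_pos.le
  have key : ‖liftG cw t htpos (⇑f) (γ • z)‖ ^ 2 ≤ C₁ ^ 2 * (z.im * Real.exp (-(κ * (z.im - 1)))) := by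
    have h2 := mul_self_le_mul_self (norm_nonneg _) hdecay
    calc ‖liftG cw t htpos (⇑f) (γ • z)‖ ^ 2 = ‖liftG cw t htpos (⇑f) (γ • z)‖ * ‖liftG cw t htpos (⇑f) (γ • z)‖ := sq _
      _ ≤ (Real.sqrt z.im * Real.exp (-(2 * π * t * (z.im - 1))) * C₁) *
          (Real.sqrt z.im * Real.exp (-(2 * π * t * (z.im - 1))) * C₁) := h2
      _ = (Real.sqrt z.im) ^ 2 * (Real.exp (-(2 * π * t * (z.im - 1)))) ^ 2 * C₁ ^ 2 := by ring
      _ = C₁ ^ 2 * (z.im * Real.exp (-(κ * (z.im - 1)))) := by rw [hexp2, hsq]; ring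
  exact key.trans (hA₀ z.im hzA).le

/-- **The cusp conditions at every cusp.** [cite: Shintani1975, §2, Prop. 2.4] -/
theorem isZeroAtImInfty_slashSq_kohnenLift (hD : Odd D) (f : CuspForm (Gamma0 32) 2) (γ : SL(2, ℤ)) :
    IsZeroAtImInfty (slashSq 3 (kohnenLift D f) γ) := by
  rcases lt_trichotomy (γ 1 0 : ℤ) 0 with hneg | hzero | hpos
  · -- replace `γ` by `-γ`
    set c : ℕ := (-(γ 1 0 : ℤ)).toNat with hcdef
    have hcpos : 0 < -(γ 1 0 : ℤ) := by linarith
    haveI : NeZero c := ⟨by rw [hcdef]; omega⟩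
    have hc : ((-γ : SL(2, ℤ)) 1 0 : ℤ) = c := by
      rw [hcdef, Int.toNat_of_nonneg hcpos.le]; simp
    have h := isZeroAtImInfty_slashSq_kohnenLift_of_pos D hD f (-γ) c hc
    rw [UpperHalfPlane.isZeroAtImInfty_iff] at h ⊢
    intro ε hε
    obtain ⟨A, hA⟩ := h ε hε
    refine ⟨A, fun z hz ↦ ?_⟩
    have := hA z hz
    rw [norm_slashSq] at this ⊢
    have hsm : (-γ : SL(2, ℤ)) • z = γ • z := by simp
    have hdn : ‖denom (-γ : SL(2, ℤ)) z‖ = ‖denom γ z‖ := by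
      rw [ModularGroup.denom_apply, ModularGroup.denom_apply]
      simp only [Matrix.SpecialLinearGroup.coe_neg, Matrix.neg_apply, Int.cast_neg]
      rw [← norm_neg]; congr 1; ring
    rwa [hsm, hdn] at this
  · exact isZeroAtImInfty_slashSq_kohnenLift_of_zero D hD f γ hzero
  · set c : ℕ := (γ 1 0 : ℤ).toNat with hcdef
    haveI : NeZero c := ⟨by rw [hcdef]; omega⟩
    have hc : (γ 1 0 : ℤ) = c := by rw [hcdef, Int.toNat_of_nonneg hpos.le]
    exact isZeroAtImInfty_slashSq_kohnenLift_of_pos D hD f γ c hc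

/-- The exponent of an orbit: `n_ω = Δ(k_ω)/D`. [folklore] -/
def kohnenExp (ω : orbitRel.Quotient (Gamma0Plus 32) (Fin 3 → ℤ)) : ℕ := (discK ω.out / D).toNat

/-- On the support of `χ_{D*}` the frequencies `Δ/D` are the naturals `kohnenExp`. [folklore] -/
theorem kohnenExp_spec (hsq : Squarefree D) (ω : orbitRel.Quotient (Gamma0Plus 32) (Fin 3 → ℤ))
    (hw : (kohnenWt D ω.out : ℂ) ≠ 0) (hpos : 0 < discK ω.out) :
    ((kohnenExp D ω : ℕ) : ℝ) = (1 / D : ℝ) * discK ω.out := by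
  have hw' : kohnenWt D ω.out ≠ 0 := by exact_mod_cast hw
  have hdvd : (D : ℤ) ∣ discK ω.out := by
    by_contra h; exact hw' (kohnenWt_of_not_dvd hsq h)
  obtain ⟨m, hm⟩ := hdvd
  have hD0 : (0 : ℤ) < D := by exact_mod_cast Nat.pos_of_ne_zero (NeZero.ne D)
  have hm0 : 0 < m := by
    rw [hm] at hpos
    exact pos_of_mul_pos_right hpos hD0.le
  have hq : discK ω.out / D = m := by rw [hm, Int.mul_ediv_cancel_left _ hD0.ne']
  rw [kohnenExp, hq, hm]
  have hD0' : (D : ℝ) ≠ 0 := by exact_mod_cast (NeZero.ne D)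
  rw [show ((m.toNat : ℕ) : ℝ) = ((m : ℤ) : ℝ) by rw [← Int.toNat_of_nonneg hm0.le]; push_cast; rw [Int.toNat_of_nonneg hm0.le]]
  push_cast
  field_simp

/-- **`Φ_D ∈ S_{3/2}(128, 1)`** for `D ≡ 3 (mod 4)` square-free and `φ ∈ S₂(Γ₀(32))`: holomorphy
(`mdifferentiable_liftG`), the level-`128` law with trivial character
(`isThetaAutomorphic_kerK`) and the cusp conditions (`isZeroAtImInfty_slashSq_kohnenLift`).
[cite: Shintani1975, §2, Thm. 1] -/
theorem kohnenLift_mem (hsq : Squarefree D) (hD3 : D % 4 = 3) (f : CuspForm (Gamma0 32) 2) :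
    kohnenLift D f ∈ halfIntCuspForms 3 128 1 := by
  have hD : Odd D := Nat.odd_iff.mpr (by omega)
  exact liftG_mem_of_cusp (1 / D) (scaleK_pos D) (invWeight32_kohnenWt hD) (bddWeight_kohnenWt D)
    (kohnenExp D) (fun ω hw hpos ↦ kohnenExp_spec D hsq ω hw hpos)
    (fun w ↦ isThetaAutomorphic_kerK D hsq hD3 w) f
    (isZeroAtImInfty_slashSq_kohnenLift D hD f)

/-- **The `q`-expansion coefficients of `Φ_D`** (`D` square-free odd): `qCoeffs Φ_D = liftCoeffG χ_{D*} (1/D) kohnenExp`.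
[cite: Shintani1975, §2, (2.15)] -/
theorem qCoeffs_kohnenLift (hsq : Squarefree D) (hD : Odd D) (f : CuspForm (Gamma0 32) 2) :
    qCoeffs (kohnenLift D f) = liftCoeffG (fun k ↦ (kohnenWt D k : ℂ)) (1 / D) (kohnenExp D) f :=
  qCoeffs_liftG (1 / D) (scaleK_pos D) (invWeight32_kohnenWt hD) (bddWeight_kohnenWt D) (kohnenExp D)
    (fun ω hw hpos ↦ kohnenExp_spec D hsq ω hw hpos) f

end Cusp

end Literature.NumberTheory.EllipticCurves.Shintani

noncomputable section

open Complex Real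
open scoped MatrixGroups

namespace Literature.NumberTheory.EllipticCurves.Shintani

open UpperHalfPlane hiding I
open CongruenceSubgroup MulAction
open Literature.NumberTheory.EllipticCurves.ModularForms

variable (D : ℕ) [NeZero D]

/-- **The normalized family** `G_D = (2/√D) Φ_D`. [cite: Tunnell1983Congruent, p. 329] -/
def kohnenFamily (f : CuspForm (Gamma0 32) 2) (z : ℍ) : ℂ := (2 / (Real.sqrt D : ℂ)) * kohnenLift D f z

/-- `G_D ∈ S_{3/2}(128, 1)` (`D ≡ 3 (mod 4)` square-free). [cite: Shintani1975, §2, Thm. 1] -/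
theorem kohnenFamily_mem (hsq : Squarefree D) (hD3 : D % 4 = 3) (f : CuspForm (Gamma0 32) 2) :
    kohnenFamily D f ∈ halfIntCuspForms 3 128 1 := by
  have h := Submodule.smul_mem (halfIntCuspForms 3 128 1) (2 / (Real.sqrt D : ℂ)) (kohnenLift_mem D hsq hD3 f)
  exact h

omit [NeZero D] in
/-- **The orbit datum** `u(ω) = sgn(λ_ω) P(ω)` (independent of the weight and the scale; `0` on
non-indefinite orbits). [folklore] -/
def orbDatum (f : CuspForm (Gamma0 32) 2) (ω : orbitRel.Quotient (Gamma0Plus 32) (Fin 3 → ℤ)) : ℂ :=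
  if h : 0 < discK ω.out then
    (((exists_orbit_dataG f ω h).choose / abs (exists_orbit_dataG f ω h).choose : ℝ) : ℂ) *
      (exists_orbit_dataG f ω h).choose_spec.choose
  else 0

/-- **The normalized orbit coefficient**: `(2/√D) coef_D(ω) = χ_{D*}(Q_ω) u(ω)`. [folklore] -/
theorem two_div_sqrt_mul_orbCoefG (f : CuspForm (Gamma0 32) 2)
    (ω : orbitRel.Quotient (Gamma0Plus 32) (Fin 3 → ℤ)) :
    (2 / (Real.sqrt D : ℂ)) * orbCoefG (fun k ↦ (kohnenWt D k : ℂ)) (1 / D) f ω =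
      kohnenWt D ω.out * orbDatum f ω := by
  unfold orbCoefG orbDatum
  have hD0 : (0 : ℝ) < D := by exact_mod_cast Nat.pos_of_ne_zero (NeZero.ne D)
  have hsD : 0 < Real.sqrt D := Real.sqrt_pos.mpr hD0
  split_ifs with h
  · have hst : Real.sqrt (1 / D) = 1 / Real.sqrt D := by
      rw [Real.sqrt_div' _ hD0.le, Real.sqrt_one]
    have hsD' : (Real.sqrt D : ℂ) ≠ 0 := by exact_mod_cast hsD.ne'
    rw [hst]
    push_cast
    field_simp
    ring
  · simp

/-- **The coefficients of `G_D`**: `a_{G_D}(n) = ∑_{ω : e_D(ω) = n} χ_{D*}(Q_ω) u(ω)`. [cite: Shintani1975, §2, (2.15)] -/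
theorem qCoeffs_kohnenFamily (hsq : Squarefree D) (hD : Odd D) (f : CuspForm (Gamma0 32) 2) (n : ℕ) :
    qCoeffs (kohnenFamily D f) n =
      ∑' ω : ((kohnenExp D) ⁻¹' {n} : Set (orbitRel.Quotient (Gamma0Plus 32) (Fin 3 → ℤ))),
        (kohnenWt D (ω : orbitRel.Quotient (Gamma0Plus 32) (Fin 3 → ℤ)).out : ℂ) * orbDatum f ω := by
  have hqc : qCoeffs (kohnenFamily D f) = fun n ↦ (2 / (Real.sqrt D : ℂ)) *
      liftCoeffG (fun k ↦ (kohnenWt D k : ℂ)) (1 / D) (kohnenExp D) f n := by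
    refine qCoeffs_eq_of_hasSum fun τ ↦ ?_
    have h := (hasSum_liftCoeffG (1 / D) (scaleK_pos D) (invWeight32_kohnenWt hD) (bddWeight_kohnenWt D)
      (kohnenExp D) (fun ω hw hpos ↦ kohnenExp_spec D hsq ω hw hpos) f τ).mul_left (2 / (Real.sqrt D : ℂ))
    refine h.congr_fun fun m ↦ ?_
    ring
  rw [hqc]
  dsimp only
  rw [liftCoeffG, ← tsum_mul_left]
  refine tsum_congr fun ω ↦ ?_
  exact two_div_sqrt_mul_orbCoefG D f ω

omit [NeZero D] in
/-- The summand of the coefficient sum, extended by zero, as a function of all orbits. [folklore] -/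
theorem tsum_fiber_eq_tsum_ite (f : CuspForm (Gamma0 32) 2) (n : ℕ) :
    ∑' ω : ((kohnenExp D) ⁻¹' {n} : Set (orbitRel.Quotient (Gamma0Plus 32) (Fin 3 → ℤ))),
        (kohnenWt D (ω : orbitRel.Quotient (Gamma0Plus 32) (Fin 3 → ℤ)).out : ℂ) * orbDatum f ω =
      ∑' ω : orbitRel.Quotient (Gamma0Plus 32) (Fin 3 → ℤ),
        (if kohnenExp D ω = n then (kohnenWt D ω.out : ℂ) * orbDatum f ω else 0) := by
  rw [← tsum_subtype_eq_of_support_subset (s := ((kohnenExp D) ⁻¹' {n} :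
    Set (orbitRel.Quotient (Gamma0Plus 32) (Fin 3 → ℤ))))]
  · refine tsum_congr fun ω ↦ ?_
    rw [if_pos (show kohnenExp D (ω : orbitRel.Quotient (Gamma0Plus 32) (Fin 3 → ℤ)) = n from ω.2)]
  · intro ω hω
    rw [Function.mem_support] at hω
    by_contra h
    exact hω (if_neg h)

omit [NeZero D] in
/-- `orbDatum` vanishes off the indefinite orbits. [folklore] -/
theorem orbDatum_of_not_pos (f : CuspForm (Gamma0 32) 2) {ω : orbitRel.Quotient (Gamma0Plus 32) (Fin 3 → ℤ)}
    (h : ¬ 0 < discK ω.out) : orbDatum f ω = 0 := by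
  rw [orbDatum, dif_neg h]

/-- **The symmetry `a_{G_D}(3) = a_{G_3}(D)`** for square-free `D ≡ 3 (mod 8)`.
[cite: Shintani1975, §2, Thm. 2] [cite: Tunnell1983Congruent, p. 329] -/
theorem qCoeffs_kohnenFamily_symm_three (hsq : Squarefree D) (hD8 : D % 8 = 3) (f : CuspForm (Gamma0 32) 2) :
    qCoeffs (kohnenFamily D f) 3 = qCoeffs (kohnenFamily 3 f) D := by
  haveI : NeZero (3 : ℕ) := ⟨by norm_num⟩
  have hD : Odd D := Nat.odd_iff.mpr (by omega)
  have h3sq : Squarefree 3 := Nat.prime_three.squarefree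
  rw [qCoeffs_kohnenFamily D hsq hD f 3, qCoeffs_kohnenFamily 3 h3sq (by decide) f D,
    tsum_fiber_eq_tsum_ite, tsum_fiber_eq_tsum_ite]
  refine tsum_congr fun ω ↦ ?_
  have hD0 : (0 : ℤ) < D := by exact_mod_cast Nat.pos_of_ne_zero hsq.ne_zero
  by_cases hΔ : discK ω.out = 3 * D
  · -- the orbits of discriminant `3D`: both indicators are on and the weights agree
    have e1 : kohnenExp D ω = 3 := by
      rw [kohnenExp, hΔ, Int.mul_ediv_cancel _ hD0.ne']; rfl
    have e2 : kohnenExp 3 ω = D := by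
      rw [kohnenExp, hΔ, show ((3 : ℕ) : ℤ) = 3 from rfl, Int.mul_ediv_cancel_left _ (by norm_num : (3 : ℤ) ≠ 0)]
      rfl
    rw [if_pos e1, if_pos e2, kohnenWt_eq_kohnenWt_three hsq hD8 hΔ]
  · -- otherwise both sides vanish
    have hL : (if kohnenExp D ω = 3 then (kohnenWt D ω.out : ℂ) * orbDatum f ω else 0) = 0 := by
      split_ifs with h
      · by_cases hpos : 0 < discK ω.out
        · have hnd : ¬ (D : ℤ) ∣ discK ω.out := by
            rintro ⟨m, hm⟩
            have hq : discK ω.out / D = m := by rw [hm, Int.mul_ediv_cancel_left _ hD0.ne']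
            have hm3 : m = 3 := by
              have h' := h
              rw [kohnenExp, hq] at h'
              have hm0 : 0 ≤ m := by
                have : (0 : ℤ) < D * m := by rw [← hm]; exact hpos
                nlinarith
              have : (m.toNat : ℤ) = 3 := by exact_mod_cast h'
              rw [Int.toNat_of_nonneg hm0] at this
              exact this
            exact hΔ (by rw [hm, hm3]; ring)
          rw [kohnenWt_of_not_dvd hsq hnd]; simp
        · rw [orbDatum_of_not_pos f hpos, mul_zero]
      · rfl
    have hR : (if kohnenExp 3 ω = D then (kohnenWt 3 ω.out : ℂ) * orbDatum f ω else 0) = 0 := by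
      split_ifs with h
      · by_cases hpos : 0 < discK ω.out
        · have hnd : ¬ ((3 : ℕ) : ℤ) ∣ discK ω.out := by
            rintro ⟨m, hm⟩
            have hq : discK ω.out / 3 = m := by
              rw [hm]; push_cast; rw [Int.mul_ediv_cancel_left _ (by norm_num : (3 : ℤ) ≠ 0)]
            have hmD : m = D := by
              have h' := h
              rw [kohnenExp, show discK ω.out / ((3 : ℕ) : ℤ) = m from hq] at h'
              have hm0 : 0 ≤ m := by
                have : (0 : ℤ) < 3 * m := by
                  have e : discK ω.out = 3 * m := by rw [hm]; push_cast; ring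
                  rw [← e]; exact hpos
                nlinarith
              have : (m.toNat : ℤ) = D := by exact_mod_cast h'
              rw [Int.toNat_of_nonneg hm0] at this
              exact this
            exact hΔ (by rw [hm, hmD]; push_cast; ring)
          rw [kohnenWt_of_not_dvd h3sq hnd]; simp
        · rw [orbDatum_of_not_pos f hpos, mul_zero]
      · rfl
    rw [hL, hR]

end Literature.NumberTheory.EllipticCurves.Shintani
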